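import Mathlib
import HarnessLib

/-!
# `RationalShortRootRigidity` — Step 1 helper (m11): the axis-Stieltjes identity descends to the reduced pair

Helper lemma INSIDE the paper proof of crux `stmt-QuantumFields-23124` (`F4SubCurvatureDoor.RationalShortRootRigidity`,
LINE g15-A of planner ym-idea-3; Step 1 = `stub_reduce` (0c)); free-hands menu IV, item (m11), statement typed in
HOME l15/Helpers23124c.lean as `Helpers.StieltjesTransfer` — proved here DEF-FREE, with `FullDeg` and `AxisStieltjes` unfolded to
their bodies exactly as in the crux text:

**Lemma** (`stieltjesTransfer`).  If `N = N₀·H`, `D = D₀·H` with `H` of full `p₀`-degree, and `N/D` is axis-Stieltjes for every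
spatial momentum `q ≠ 0` (`N(t,q) = D(t,q)·(c(t²) + Σ rⱼ/(t² + ωⱼ²))` for all `t`), then so is `N₀/D₀` with the same data.

Proof.  Fix `q ≠ 0`.  The fibre `t ↦ H(t,q)` is a NON-ZERO real polynomial: its `t^{deg H}`-coefficient is the constant
`coeff(p₀^{deg H}) H ≠ 0` (`MvPolynomial.finSuccEquiv_coeff_coeff`, `totalDegree_coeff_finSuccEquiv_add_le`).  Off its finitely
many roots the factor `H(t,q)` cancels; both sides of the identity for `(N₀, D₀)` are continuous in `t` (`ωⱼ > 0`), and the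
complement of a finite set is dense in `ℝ` (`Set.Countable.dense_compl`), so the identity holds everywhere (`Continuous.ext_on`).

Mathlib only; THEOREMS ONLY (no definitions); no named facts; no `sorry`; default heartbeats.  Nothing about the crux 23124, the
route's rung or the Yang–Mills mass gap is proved here.  Free-hands seat `ym-line-frs-p2` g10 (announced on the owner's bus
2026-08-28T21:10Z), `--supports stmt-QuantumFields-23124`.
-/

set_option autoImplicit false

namespace Summit.QuantumFields.YangMills.Theorems.RationalShortRootRigidity

open scoped BigOperators Polynomial

/-- The fibre `t ↦ H(t,q)` of a polynomial of full `p₀`-degree is a non-zero real polynomial, for EVERY `q`. [folklore] -/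
theorem fibre_ne_zero_of_fullDeg (H : MvPolynomial (Fin 4) ℝ)
    (hH : MvPolynomial.coeff (Finsupp.single 0 H.totalDegree) H ≠ 0) (q : Fin 3 → ℝ) :
    Polynomial.map (MvPolynomial.eval q) (MvPolynomial.finSuccEquiv ℝ 3 H) ≠ 0 := by
  set d := H.totalDegree with hd
  have hc0 : MvPolynomial.coeff 0 ((MvPolynomial.finSuccEquiv ℝ 3 H).coeff d) =
      MvPolynomial.coeff (Finsupp.single 0 d) H := by
    rw [MvPolynomial.finSuccEquiv_coeff_coeff, Finsupp.cons_zero_eq_single_zero]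
  have hne : (MvPolynomial.finSuccEquiv ℝ 3 H).coeff d ≠ 0 := by
    intro h0; rw [h0, MvPolynomial.coeff_zero] at hc0; exact hH hc0.symm
  have htd := MvPolynomial.totalDegree_coeff_finSuccEquiv_add_le H d hne
  have htd0 : ((MvPolynomial.finSuccEquiv ℝ 3 H).coeff d).totalDegree = 0 := by omega
  rw [MvPolynomial.totalDegree_eq_zero_iff_eq_C, hc0] at htd0
  intro h0
  have h1 := congrArg (fun p : ℝ[X] => p.coeff d) h0
  simp only [Polynomial.coeff_map, Polynomial.coeff_zero] at h1
  rw [htd0, MvPolynomial.eval_C] at h1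
  exact hH h1

/-- **The axis-Stieltjes identity descends to the reduced pair** (m11; Step 1 (0c) of the paper proof of 23124).  The statement
is the body of `Helpers.StieltjesTransfer` (HOME l15/Helpers23124c.lean) with `FullDeg` / `AxisStieltjes` unfolded as in the crux
text. [folklore] -/
theorem stieltjesTransfer :
    ∀ N D N₀ D₀ H : MvPolynomial (Fin 4) ℝ, N = N₀ * H → D = D₀ * H →
      MvPolynomial.coeff (Finsupp.single 0 H.totalDegree) H ≠ 0 →
      (∀ q : Fin 3 → ℝ, q ≠ 0 → ∃ (k : ℕ) (ω r : Fin k → ℝ) (c : Polynomial ℝ),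
        (∀ j, 0 < ω j) ∧ (∀ j, 0 ≤ r j) ∧
        ∀ t : ℝ, MvPolynomial.eval (Fin.cons t q) N =
          MvPolynomial.eval (Fin.cons t q) D * (c.eval (t ^ 2) + ∑ j, r j / (t ^ 2 + ω j ^ 2))) →
      (∀ q : Fin 3 → ℝ, q ≠ 0 → ∃ (k : ℕ) (ω r : Fin k → ℝ) (c : Polynomial ℝ),
        (∀ j, 0 < ω j) ∧ (∀ j, 0 ≤ r j) ∧
        ∀ t : ℝ, MvPolynomial.eval (Fin.cons t q) N₀ =
          MvPolynomial.eval (Fin.cons t q) D₀ * (c.eval (t ^ 2) + ∑ j, r j / (t ^ 2 + ω j ^ 2))) := by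
  intro N D N₀ D₀ H hN hD hH hAS q hq
  obtain ⟨k, ω, r, c, hω, hr, hid⟩ := hAS q hq
  refine ⟨k, ω, r, c, hω, hr, ?_⟩
  -- fibre polynomials
  have hfib : ∀ (P : MvPolynomial (Fin 4) ℝ) (t : ℝ),
      (Polynomial.map (MvPolynomial.eval q) (MvPolynomial.finSuccEquiv ℝ 3 P)).eval t =
        MvPolynomial.eval (Fin.cons t q) P :=
    fun P t => (MvPolynomial.eval_eq_eval_mv_eval' q t P).symm
  set h : ℝ[X] := Polynomial.map (MvPolynomial.eval q) (MvPolynomial.finSuccEquiv ℝ 3 H) with hh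
  have hh0 : h ≠ 0 := fibre_ne_zero_of_fullDeg H hH q
  -- off the roots of `h`, cancel the factor `H(t,q)`
  have hoff : ∀ t : ℝ, h.eval t ≠ 0 → MvPolynomial.eval (Fin.cons t q) N₀ =
      MvPolynomial.eval (Fin.cons t q) D₀ * (c.eval (t ^ 2) + ∑ j, r j / (t ^ 2 + ω j ^ 2)) := by
    intro t ht
    have h1 := hid t
    rw [hN, hD, map_mul, map_mul, ← hfib H t] at h1
    have h2 : MvPolynomial.eval (Fin.cons t q) N₀ * h.eval t =
        (MvPolynomial.eval (Fin.cons t q) D₀ * (c.eval (t ^ 2) + ∑ j, r j / (t ^ 2 + ω j ^ 2))) * h.eval t := by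
      rw [h1]; ring
    exact mul_right_cancel₀ ht h2
  -- both sides are continuous in `t`
  have hF : Continuous fun t : ℝ => MvPolynomial.eval (Fin.cons t q) N₀ := by
    have : (fun t : ℝ => MvPolynomial.eval (Fin.cons t q) N₀) =
        fun t => (Polynomial.map (MvPolynomial.eval q) (MvPolynomial.finSuccEquiv ℝ 3 N₀)).eval t :=
      funext fun t => (hfib N₀ t).symm
    rw [this]; exact Polynomial.continuous _
  have hG : Continuous fun t : ℝ =>
      MvPolynomial.eval (Fin.cons t q) D₀ * (c.eval (t ^ 2) + ∑ j, r j / (t ^ 2 + ω j ^ 2)) := by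
    have hD₀ : Continuous fun t : ℝ => MvPolynomial.eval (Fin.cons t q) D₀ := by
      have : (fun t : ℝ => MvPolynomial.eval (Fin.cons t q) D₀) =
          fun t => (Polynomial.map (MvPolynomial.eval q) (MvPolynomial.finSuccEquiv ℝ 3 D₀)).eval t :=
        funext fun t => (hfib D₀ t).symm
      rw [this]; exact Polynomial.continuous _
    refine hD₀.mul ((c.continuous.comp (continuous_pow 2)).add (continuous_finsetSum _ fun j _ => ?_))
    exact continuous_const.div (by fun_prop) fun t => by have := hω j; positivity
  -- the complement of the (finite) root set of `h` is dense
  have hdense : Dense {t : ℝ | h.eval t ≠ 0} := by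
    have hfin : {t : ℝ | h.eval t = 0}.Finite := by
      refine (h.roots.toFinset.finite_toSet).subset fun t ht => ?_
      simp only [Set.mem_setOf_eq] at ht
      simp only [Finset.mem_coe, Multiset.mem_toFinset]
      exact (Polynomial.mem_roots hh0).2 ht
    have := Set.Countable.dense_compl ℝ hfin.countable
    simpa only [Set.compl_setOf] using this
  have heq := Continuous.ext_on hdense hF hG fun t ht => hoff t ht
  intro t
  exact congrFun heq t

end Summit.QuantumFields.YangMills.Theorems.RationalShortRootRigidity
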